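import Summits.NavierStokesRegularity.NavierStokesRegularity.Theorems.RungBlowupCofinal.SolidHarmonicAnsatz
import Literature.Analysis.FluidPDE.CaloricRemainderCalculus
import Literature.Analysis.FluidPDE.RadialCalculus
import Literature.Analysis.FluidPDE.DistributionalPressurePoisson
import Literature.Analysis.FluidPDE.LerayProfileCalculus
import HarnessLib

/-!
# The Leray profile operator `A = −Δ + ½ + ½ y·∇` on solid-harmonic lifts: the three-lift ansatz
# `a(ρ)∇φ + b(ρ)φx + c(ρ) x × ∇φ` (`ρ = ‖x‖²`) of a solid harmonic of degree `j` is INVARIANT, and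
# `A` acts on the radial profiles as an explicit triangular second-order radial operator
# (route `AngularGalerkinLadder`, crux K1 `RungBlowupCofinal`; kinematic/linear helper, theorems only)

Cell `ns-blowup`, seat `ns-blowup-circuit` (g11, AGL Lean seat). Helper file for
`stmt-NavierStokesRegularity-19959` serving the line `Cruxes/RungBlowupCofinal/Lines/qlwave.lean`,
whose card (§2 «FIRST RUNG = a radial BVP») reduces every fixed rung of the mean–wave system to
coupled second-order RADIAL ODEs «governed at `r = ∞` by the linear operator `A` (OU drift)». The
LINEAR part of both the zonal and the wave equation of `Qlwave.IsMeanWaveProfile` is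
`A U = −ΔU + ½U + ½DU·y` (letters `-(Δ V) y + (1/2) • V y + (1/2) • fderiv ℝ V y y`); this file
computes it in closed form on the three lifts of `SolidHarmonicLifts.lean` /
`SolidHarmonicAnsatz.lean`. LABEL: KERNEL (linear algebra of the MODEL's profile operator).
Nothing here asserts a Theses declaration; no definition, no named fact. WHAT THIS IS NOT: not
Navier–Stokes evidence; not a profile; nothing about the nonlinear terms `(V·∇)W + (W·∇)V`,
`meanStress`, the pressures or the defects — only the linear operator `A` on explicit ansätze.

## Content

* §1 radial profiles: `gradient_radial` (`∇a(ρ) = 2a′y`), `laplacian_radial` (`Δa(ρ) = 4ρa″ + 6a′`,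
  tree `laplacian_comp_norm_sq`), **`laplacian_radial_smul`** (`Δ(a(ρ)u) = aΔu + 4a′Du·y +
  (4ρa″ + 6a′)u`, tree `laplacian_smul_field`), `fderiv_radial_smul_self` (`D(a(ρ)u)·y = 2ρa′u + aDu·y`).
* §2 the lifts of a solid harmonic `φ` of degree `j` (`Δφ = 0`, `Dφ(y)y = jφ`):
  `fderiv_gradient_self` (`D∇φ·y = (j−1)∇φ`), `laplacian_gradient_of_harmonic` (`Δ∇φ = 0`, tree
  `laplacian_gradient`), `fderiv_smulSelf_self` (`D(φx)·y = (j+1)φx`), **`laplacian_smulSelf`**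
  (`Δ(φx) = 2∇φ`), `fderiv_crossSelf_gradient_self` (`D(x × ∇φ)·y = j x × ∇φ`),
  `crossSelf_gradient_eq_sum` (`x × ∇φ = Σ_a Dφ(x)(e_a × x) e_a`),
  **`laplacian_crossSelf_gradient_of_harmonic`** (`Δ(x × ∇φ) = 0`: derivatives along rotation
  fields commute with `Δ`, tree `laplacian_fderiv_apply_clm_of_skew`).
* §3 **`profileOp_gradientLift`**: `A(a(ρ)∇φ) = (−4ρa″ + (ρ−4j−2)a′ + (j/2)a)∇φ`;
  **`profileOp_radialLift`**: `A(b(ρ)φx) = (−4ρb″ + (ρ−4j−10)b′ + ((j+2)/2)b)φx − 2b∇φ`;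
  **`profileOp_toroidalLift`**: `A(c(ρ)x × ∇φ) = (−4ρc″ + (ρ−4j−6)c′ + ((j+1)/2)c) x × ∇φ`;
  **`profileOp_threeLift`**: the assembled triangular action on `(a, b, c)` — the three-lift class
  is invariant under `A`, the toroidal profile decouples, the radial profile feeds the gradient one.

Reading for the line: on the sectoral class of `SectoralWaveAnsatz.lean` (`φ = Re(y₀+iy₁)ⁿ`) and on
any zonal solid-harmonic lift these are the «`O(L)` coupled second-order radial ODEs on `(0, ∞)`,
regular-singular at `r = 0`, OU drift at `r = ∞`» of the card's §1–§2 — their LINEAR part, now kernel;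
the precession letter `αJ₃` maps the `Re`-class to the `Im`-class (`SolidHarmonicTransport`), and the
nonlinear/pressure/defect letters remain untyped. [cite: BullardGellman1954] (vector spherical
harmonics with radial coefficients diagonalise rotation-invariant second-order operators).
-/

noncomputable section

namespace Summit.NavierStokesRegularity.AngularGalerkinLadderSolidHarmonicProfileOperator

open Set Function MeasureTheory
open scoped ContDiff RealInnerProductSpace Laplacian
open Literature.Analysis.FluidPDE
open Summit.NavierStokesRegularity.FluidComputer
open Summit.NavierStokesRegularity.FluidComputer.AngularLadder
open Summit.NavierStokesRegularity.AngularGalerkinLadderToroidalLift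
open Summit.NavierStokesRegularity.AngularGalerkinLadderSolidHarmonicLifts

variable {φ : EuclideanSpace ℝ (Fin 3) → ℝ} {u : EuclideanSpace ℝ (Fin 3) → EuclideanSpace ℝ (Fin 3)}
  {a : ℝ → ℝ} {j : ℕ}

/-! ## §1 Radial profiles: gradient, Laplacian, and the product rules -/

/-- The derivative of a radial profile: `D(a(‖·‖²))(y) w = a′(‖y‖²) · 2⟪y, w⟫`. [folklore] -/
private theorem fderiv_radial_apply (ha : Differentiable ℝ a) (y w : EuclideanSpace ℝ (Fin 3)) :
    fderiv ℝ (fun x : EuclideanSpace ℝ (Fin 3) => a (‖x‖ ^ 2)) y w = deriv a (‖y‖ ^ 2) * (2 * ⟪y, w⟫) := by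
  have h : HasFDerivAt (fun x : EuclideanSpace ℝ (Fin 3) => a (‖x‖ ^ 2))
      (deriv a (‖y‖ ^ 2) • (2 : ℕ) • innerSL ℝ y) y :=
    ((ha (‖y‖ ^ 2)).hasDerivAt).comp_hasFDerivAt y (hasStrictFDerivAt_norm_sq y).hasFDerivAt
  rw [h.fderiv]
  simp

/-- **The gradient of a radial profile**: `∇(a(‖·‖²))(y) = 2a′(‖y‖²) y`. [folklore] -/
theorem gradient_radial (ha : Differentiable ℝ a) (y : EuclideanSpace ℝ (Fin 3)) :
    gradient (fun x : EuclideanSpace ℝ (Fin 3) => a (‖x‖ ^ 2)) y = (2 * deriv a (‖y‖ ^ 2)) • y := by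
  refine ext_inner_right ℝ fun w => ?_
  rw [inner_gradient_left, fderiv_radial_apply ha, real_inner_smul_left]
  ring

/-- **The Laplacian of a radial profile on `ℝ³`**: `Δ(a(‖·‖²))(y) = 4‖y‖² a″(‖y‖²) + 6 a′(‖y‖²)`
(tree `laplacian_comp_norm_sq`). [folklore] -/
theorem laplacian_radial (ha : ContDiff ℝ ∞ a) (y : EuclideanSpace ℝ (Fin 3)) :
    (Δ fun x : EuclideanSpace ℝ (Fin 3) => a (‖x‖ ^ 2)) y =
      4 * ‖y‖ ^ 2 * deriv (deriv a) (‖y‖ ^ 2) + 6 * deriv a (‖y‖ ^ 2) := by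
  have had : Differentiable ℝ a := ha.differentiable (by simp)
  have hda : Differentiable ℝ (deriv a) := (contDiff_infty_iff_deriv.1 ha).2.differentiable (by simp)
  rw [laplacian_comp_norm_sq (U := univ) isOpen_univ (fun σ _ => (had σ).hasDerivAt) (mem_univ _)
    ((hda _).hasDerivAt), finrank_euclideanSpace_fin]
  push_cast
  ring

/-- A radial profile of a smooth function is smooth. [folklore] -/
private theorem contDiff_radial (ha : ContDiff ℝ ∞ a) :
    ContDiff ℝ ∞ fun x : EuclideanSpace ℝ (Fin 3) => a (‖x‖ ^ 2) :=
  ha.comp (contDiff_norm_sq ℝ)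

/-- **Laplacian of a radially cut-off field**:
`Δ(a(‖·‖²) u)(y) = a Δu + 4a′ Du(y) y + (4‖y‖² a″ + 6a′) u(y)`. [folklore] -/
theorem laplacian_radial_smul (ha : ContDiff ℝ ∞ a) (hu : ContDiff ℝ ∞ u) (y : EuclideanSpace ℝ (Fin 3)) :
    (Δ fun x : EuclideanSpace ℝ (Fin 3) => a (‖x‖ ^ 2) • u x) y =
      a (‖y‖ ^ 2) • (Δ u) y + (4 * deriv a (‖y‖ ^ 2)) • fderiv ℝ u y y +
        (4 * ‖y‖ ^ 2 * deriv (deriv a) (‖y‖ ^ 2) + 6 * deriv a (‖y‖ ^ 2)) • u y := by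
  have had : Differentiable ℝ a := ha.differentiable (by simp)
  rw [laplacian_smul_field ((contDiff_radial ha).of_le (by norm_cast)) (hu.of_le (by norm_cast)) y,
    gradient_radial had, laplacian_radial ha, map_smul, smul_smul]
  congr 1
  congr 1
  ring_nf

/-- **Radial derivative of a radially cut-off field**:
`D(a(‖·‖²) u)(y) y = 2‖y‖² a′ u(y) + a Du(y) y`. [folklore] -/
theorem fderiv_radial_smul_self (ha : Differentiable ℝ a) (hu : Differentiable ℝ u)
    (y : EuclideanSpace ℝ (Fin 3)) :
    fderiv ℝ (fun x : EuclideanSpace ℝ (Fin 3) => a (‖x‖ ^ 2) • u x) y y =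
      (2 * ‖y‖ ^ 2 * deriv a (‖y‖ ^ 2)) • u y + a (‖y‖ ^ 2) • fderiv ℝ u y y := by
  have hc : HasFDerivAt (fun x : EuclideanSpace ℝ (Fin 3) => a (‖x‖ ^ 2))
      (fderiv ℝ (fun x : EuclideanSpace ℝ (Fin 3) => a (‖x‖ ^ 2)) y) y :=
    (((ha (‖y‖ ^ 2)).hasDerivAt).comp_hasFDerivAt y
      (hasStrictFDerivAt_norm_sq y).hasFDerivAt).differentiableAt.hasFDerivAt
  have hprod : HasFDerivAt (fun x : EuclideanSpace ℝ (Fin 3) => a (‖x‖ ^ 2) • u x)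
      (a (‖y‖ ^ 2) • fderiv ℝ u y +
        (fderiv ℝ (fun x : EuclideanSpace ℝ (Fin 3) => a (‖x‖ ^ 2)) y).smulRight (u y)) y :=
    hc.smul (hu y).hasFDerivAt
  rw [hprod.fderiv]
  simp only [_root_.add_apply, FunLike.coe_smul, Pi.smul_apply,
    ContinuousLinearMap.smulRight_apply, fderiv_radial_apply ha, real_inner_self_eq_norm_sq]
  rw [add_comm]
  congr 1
  ring_nf

/-! ## §2 First and second derivatives of the three lifts of a solid harmonic -/

/-- `⟪D(∇φ)(x) h, w⟫ = D²φ(x)(h)(w)` for smooth `φ`. [folklore] -/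
private theorem inner_fderiv_gradient_apply' (hφ : ContDiff ℝ ∞ φ) (x h w : EuclideanSpace ℝ (Fin 3)) :
    ⟪fderiv ℝ (gradient φ) x h, w⟫ = fderiv ℝ (fderiv ℝ φ) x h w := by
  set Lr : (EuclideanSpace ℝ (Fin 3) →L[ℝ] ℝ) →L[ℝ] EuclideanSpace ℝ (Fin 3) :=
    (InnerProductSpace.toDual ℝ (EuclideanSpace ℝ (Fin 3))).symm.toContinuousLinearEquiv.toContinuousLinearMap
    with hLr
  have hLapp : ∀ l : EuclideanSpace ℝ (Fin 3) →L[ℝ] ℝ,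
      Lr l = (InnerProductSpace.toDual ℝ (EuclideanSpace ℝ (Fin 3))).symm l := fun l => rfl
  have h1 : gradient φ = fun y => Lr (fderiv ℝ φ y) := rfl
  have hd : DifferentiableAt ℝ (fderiv ℝ φ) x :=
    (contDiff_infty_iff_fderiv.1 hφ).2.differentiable (by simp) x
  have h2 : HasFDerivAt (fun y => Lr (fderiv ℝ φ y)) (Lr.comp (fderiv ℝ (fderiv ℝ φ) x)) x :=
    Lr.hasFDerivAt.comp x hd.hasFDerivAt
  rw [h1, h2.fderiv, ContinuousLinearMap.comp_apply, hLapp, InnerProductSpace.toDual_symm_apply]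

/-- The gradient field of a smooth function is smooth. [folklore] -/
private theorem contDiff_gradient' (hφ : ContDiff ℝ ∞ φ) : ContDiff ℝ ∞ (gradient φ) := by
  set Lr : (EuclideanSpace ℝ (Fin 3) →L[ℝ] ℝ) →L[ℝ] EuclideanSpace ℝ (Fin 3) :=
    (InnerProductSpace.toDual ℝ (EuclideanSpace ℝ (Fin 3))).symm.toContinuousLinearEquiv.toContinuousLinearMap
    with hLr
  have h1 : gradient φ = fun y => Lr (fderiv ℝ φ y) := rfl
  rw [h1]
  exact Lr.contDiff.comp (contDiff_infty_iff_fderiv.1 hφ).2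

/-- **Homogeneity of the gradient**: `Dφ(y)y = jφ(y)` for all `y` ⇒ `D(∇φ)(y) y = (j−1) ∇φ(y)`
(Euler's identity differentiated, Schwarz). [folklore] -/
theorem fderiv_gradient_self (hφ : ContDiff ℝ ∞ φ) (hE : ∀ y, fderiv ℝ φ y y = (j : ℝ) * φ y)
    (y : EuclideanSpace ℝ (Fin 3)) :
    fderiv ℝ (gradient φ) y y = ((j : ℝ) - 1) • gradient φ y := by
  refine ext_inner_right ℝ fun w => ?_
  rw [inner_fderiv_gradient_apply' hφ, fderiv_fderiv_symm hφ y y w, real_inner_smul_left,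
    inner_gradient_left]
  have h1 := fderiv_fderiv_apply_clm hφ (ContinuousLinearMap.id ℝ _) y w
  simp only [ContinuousLinearMap.coe_id', id] at h1
  have h2 : (fun z => fderiv ℝ φ z z) = fun z => (j : ℝ) * φ z := funext hE
  rw [h2, fderiv_const_mul ((hφ.differentiable (by simp)) y), FunLike.coe_smul, Pi.smul_apply,
    smul_eq_mul] at h1
  linarith [h1]

/-- **The gradient of a harmonic function is harmonic**: `Δ(∇φ) = ∇(Δφ) = 0` (tree
`laplacian_gradient`). [folklore] -/
theorem laplacian_gradient_of_harmonic (hφ : ContDiff ℝ ∞ φ) (hΔ : ∀ y, (Δ φ) y = 0)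
    (y : EuclideanSpace ℝ (Fin 3)) : (Δ (gradient φ)) y = 0 := by
  rw [laplacian_gradient (hφ.of_le (by norm_cast)) y, show (Δ φ) = fun _ => (0 : ℝ) from funext hΔ]
  refine ext_inner_right ℝ fun w => ?_
  rw [inner_gradient_left, inner_zero_left]
  simp

/-- **Radial derivative of the radial lift**: `D(φ x)(y) y = (j+1) φ(y) y`. [folklore] -/
theorem fderiv_smulSelf_self (hφ : ContDiff ℝ ∞ φ) (hE : ∀ y, fderiv ℝ φ y y = (j : ℝ) * φ y)
    (y : EuclideanSpace ℝ (Fin 3)) :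
    fderiv ℝ (fun x : EuclideanSpace ℝ (Fin 3) => φ x • x) y y = ((j : ℝ) + 1) • (φ y • y) := by
  have hd : HasFDerivAt (fun x : EuclideanSpace ℝ (Fin 3) => φ x • x)
      (φ y • ContinuousLinearMap.id ℝ _ + (fderiv ℝ φ y).smulRight y) y :=
    (((hφ.differentiable (by simp)) y).hasFDerivAt).smul (hasFDerivAt_id y)
  rw [hd.fderiv]
  simp only [_root_.add_apply, FunLike.coe_smul, Pi.smul_apply, ContinuousLinearMap.coe_id', id,
    ContinuousLinearMap.smulRight_apply, hE y, smul_smul]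
  rw [← add_smul]
  congr 1
  ring

/-- **Laplacian of the radial lift**: `Δ(φ x)(y) = 2∇φ(y) + (Δφ)(y) y`; for harmonic `φ`,
`Δ(φ x) = 2∇φ`. [folklore] -/
theorem laplacian_smulSelf (hφ : ContDiff ℝ ∞ φ) (hΔ : ∀ y, (Δ φ) y = 0) (y : EuclideanSpace ℝ (Fin 3)) :
    (Δ fun x : EuclideanSpace ℝ (Fin 3) => φ x • x) y = (2 : ℝ) • gradient φ y := by
  have hid : ContDiff ℝ 2 (fun x : EuclideanSpace ℝ (Fin 3) => x) := contDiff_id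
  rw [laplacian_smul_field (hφ.of_le (by norm_cast)) hid y, laplacian_id_eq_zero, hΔ y, fderiv_fun_id]
  simp

/-- **Radial derivative of the toroidal lift**: `D(x × ∇φ)(y) y = j · y × ∇φ(y)`. [folklore] -/
theorem fderiv_crossSelf_gradient_self (hφ : ContDiff ℝ ∞ φ) (hE : ∀ y, fderiv ℝ φ y y = (j : ℝ) * φ y)
    (y : EuclideanSpace ℝ (Fin 3)) :
    fderiv ℝ (fun x => cross x (gradient φ x)) y y = (j : ℝ) • cross y (gradient φ y) := by
  rw [fderiv_crossSelf_apply (((contDiff_gradient' hφ).differentiable (by simp)) y),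
    fderiv_gradient_self hφ hE y, ← crossCLM_apply, ← crossCLM_apply, map_smul]
  rw [show (j : ℝ) • crossCLM y (gradient φ y) = (1 : ℝ) • crossCLM y (gradient φ y) +
      ((j : ℝ) - 1) • crossCLM y (gradient φ y) by rw [← add_smul]; congr 1; ring, one_smul]

/-- The toroidal lift in coordinates: `x × g = Σ_a ⟪g, e_a × x⟫ e_a`. [folklore] -/
private theorem cross_eq_sum_inner_crossCLM (x g : EuclideanSpace ℝ (Fin 3)) :
    cross x g = ∑ a : Fin 3, ⟪g, crossCLM (axis a) x⟫ • axis a := by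
  rw [Fin.sum_univ_three]
  apply PiLp.ext
  intro i
  fin_cases i <;>
    simp [crossCLM_apply, cross, cross_apply, axis_apply, PiLp.inner_apply, Fin.sum_univ_three] <;> ring

/-- The toroidal lift through the scalar rotation derivatives:
`x × ∇φ(x) = Σ_a Dφ(x)(e_a × x) e_a` (i.e. `(x × ∇φ)_a = −K_aφ`). [folklore] -/
theorem crossSelf_gradient_eq_sum (φ : EuclideanSpace ℝ (Fin 3) → ℝ) :
    (fun x => cross x (gradient φ x)) =
      fun x => ∑ a : Fin 3, (fderiv ℝ φ x (crossCLM (axis a) x)) • axis a := by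
  funext x
  rw [cross_eq_sum_inner_crossCLM]
  simp only [inner_gradient_left]

/-- The Laplacian of `s(x) v` for a fixed vector `v` is `(Δs)(x) v`. [folklore] -/
private theorem laplacian_smul_const {s : EuclideanSpace ℝ (Fin 3) → ℝ} (hs : ContDiff ℝ ∞ s)
    (v y : EuclideanSpace ℝ (Fin 3)) :
    (Δ fun x : EuclideanSpace ℝ (Fin 3) => s x • v) y = ((Δ s) y) • v := by
  rw [laplacian_smul_field (hs.of_le (by norm_cast)) (contDiff_const.of_le le_top) y]
  have h0 : (Δ fun _ : EuclideanSpace ℝ (Fin 3) => v) y = 0 := by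
    rw [InnerProductSpace.laplacian_eq_iteratedFDeriv_orthonormalBasis _ (EuclideanSpace.basisFun (Fin 3) ℝ)]
    simp [iteratedFDeriv_two_apply]
  rw [h0]
  simp

/-- **The toroidal lift of a harmonic function is harmonic**: `Δ(x × ∇φ(x)) = 0` — each
component `Dφ(·)(e_a × ·)` is a derivative along a skew (rotation) field, which commutes with `Δ`
(tree `laplacian_fderiv_apply_clm_of_skew`). [folklore] -/
theorem laplacian_crossSelf_gradient_of_harmonic (hφ : ContDiff ℝ ∞ φ) (hΔ : ∀ y, (Δ φ) y = 0)
    (y : EuclideanSpace ℝ (Fin 3)) : (Δ fun x => cross x (gradient φ x)) y = 0 := by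
  have hs : ∀ a : Fin 3, ContDiff ℝ ∞ fun x => fderiv ℝ φ x (crossCLM (axis a) x) :=
    fun a => contDiff_fderiv_apply_clm hφ (crossCLM (axis a))
  have hK : ∀ a : Fin 3, ∀ v w : EuclideanSpace ℝ (Fin 3),
      ⟪crossCLM (axis a) v, w⟫ = -⟪v, crossCLM (axis a) w⟫ := fun a v w => by
    simp only [crossCLM_apply, cross, PiLp.inner_apply, cross_apply, RCLike.inner_apply,
      conj_trivial, Fin.sum_univ_three, Matrix.cons_val_zero, Matrix.cons_val_one,
      Matrix.cons_val_two, Matrix.head_cons, Matrix.tail_cons]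
    ring
  have hΔs : ∀ a : Fin 3, (Δ fun x => fderiv ℝ φ x (crossCLM (axis a) x)) y = 0 := fun a => by
    rw [laplacian_fderiv_apply_clm_of_skew hφ (hK a), show (Δ φ) = fun _ => (0 : ℝ) from funext hΔ]
    simp
  have hterm : ∀ a : Fin 3, ContDiff ℝ ∞ fun x : EuclideanSpace ℝ (Fin 3) =>
      (fderiv ℝ φ x (crossCLM (axis a) x)) • axis a := fun a => (hs a).smul contDiff_const
  rw [crossSelf_gradient_eq_sum φ]
  have e3 : (fun x : EuclideanSpace ℝ (Fin 3) => ∑ a : Fin 3, (fderiv ℝ φ x (crossCLM (axis a) x)) • axis a)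
      = (fun x => (fderiv ℝ φ x (crossCLM (axis 0) x)) • axis 0) +
        (fun x => (fderiv ℝ φ x (crossCLM (axis 1) x)) • axis 1) +
        fun x => (fderiv ℝ φ x (crossCLM (axis 2) x)) • axis 2 := by
    funext x
    rw [Fin.sum_univ_three]
    rfl
  have h01 : ContDiff ℝ ∞ ((fun x : EuclideanSpace ℝ (Fin 3) => (fderiv ℝ φ x (crossCLM (axis 0) x)) • axis 0) +
      fun x => (fderiv ℝ φ x (crossCLM (axis 1) x)) • axis 1) := (hterm 0).add (hterm 1)
  rw [e3, ((h01.of_le (by norm_cast)).contDiffAt).laplacian_add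
      (((hterm 2).of_le (by norm_cast)).contDiffAt),
    ((((hterm 0)).of_le (by norm_cast)).contDiffAt).laplacian_add
      (((hterm 1).of_le (by norm_cast)).contDiffAt)]
  simp only [laplacian_smul_const (hs _), hΔs, zero_smul, add_zero]

/-! ## §3 The Leray profile operator `A = −Δ + ½ + ½ y·∇` on the radially cut-off lifts -/

section ProfileOperator

variable {b c : ℝ → ℝ}

/-- **`A` on the cut-off GRADIENT lift of a solid harmonic of degree `j`**:
`A(a(ρ)∇φ) = (−4ρa″ + (ρ − 4j − 2)a′ + (j/2)a)(ρ) · ∇φ`, `ρ = ‖y‖²`. [folklore] -/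
theorem profileOp_gradientLift (ha : ContDiff ℝ ∞ a) (hφ : ContDiff ℝ ∞ φ) (hΔ : ∀ y, (Δ φ) y = 0)
    (hE : ∀ y, fderiv ℝ φ y y = (j : ℝ) * φ y) (y : EuclideanSpace ℝ (Fin 3)) :
    -(Δ fun x : EuclideanSpace ℝ (Fin 3) => a (‖x‖ ^ 2) • gradient φ x) y +
        (1 / 2 : ℝ) • (a (‖y‖ ^ 2) • gradient φ y) +
        (1 / 2 : ℝ) • fderiv ℝ (fun x : EuclideanSpace ℝ (Fin 3) => a (‖x‖ ^ 2) • gradient φ x) y y =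
      (-4 * ‖y‖ ^ 2 * deriv (deriv a) (‖y‖ ^ 2) + (‖y‖ ^ 2 - 4 * (j : ℝ) - 2) * deriv a (‖y‖ ^ 2) +
        (j : ℝ) / 2 * a (‖y‖ ^ 2)) • gradient φ y := by
  have hG : ContDiff ℝ ∞ (gradient φ) := contDiff_gradient' hφ
  rw [laplacian_radial_smul ha hG y, laplacian_gradient_of_harmonic hφ hΔ y,
    fderiv_radial_smul_self (ha.differentiable (by simp)) (hG.differentiable (by simp)) y,
    fderiv_gradient_self hφ hE y]
  module

/-- **`A` on the cut-off RADIAL lift**: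
`A(b(ρ)φx) = (−4ρb″ + (ρ − 4j − 10)b′ + ((j+2)/2)b)(ρ) · φx − 2b(ρ) · ∇φ` — the radial lift feeds
the gradient lift (`Δ(φx) = 2∇φ`). [folklore] -/
theorem profileOp_radialLift (hb : ContDiff ℝ ∞ b) (hφ : ContDiff ℝ ∞ φ) (hΔ : ∀ y, (Δ φ) y = 0)
    (hE : ∀ y, fderiv ℝ φ y y = (j : ℝ) * φ y) (y : EuclideanSpace ℝ (Fin 3)) :
    -(Δ fun x : EuclideanSpace ℝ (Fin 3) => b (‖x‖ ^ 2) • (φ x • x)) y +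
        (1 / 2 : ℝ) • (b (‖y‖ ^ 2) • (φ y • y)) +
        (1 / 2 : ℝ) • fderiv ℝ (fun x : EuclideanSpace ℝ (Fin 3) => b (‖x‖ ^ 2) • (φ x • x)) y y =
      (-4 * ‖y‖ ^ 2 * deriv (deriv b) (‖y‖ ^ 2) + (‖y‖ ^ 2 - 4 * (j : ℝ) - 10) * deriv b (‖y‖ ^ 2) +
        ((j : ℝ) + 2) / 2 * b (‖y‖ ^ 2)) • (φ y • y) - (2 * b (‖y‖ ^ 2)) • gradient φ y := by
  have hS : ContDiff ℝ ∞ (fun x : EuclideanSpace ℝ (Fin 3) => φ x • x) := contDiff_smulSelf hφ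
  rw [laplacian_radial_smul hb hS y, laplacian_smulSelf hφ hΔ y,
    fderiv_radial_smul_self (hb.differentiable (by simp)) (hS.differentiable (by simp)) y,
    fderiv_smulSelf_self hφ hE y]
  module

/-- **`A` on the cut-off TOROIDAL lift**:
`A(c(ρ) x × ∇φ) = (−4ρc″ + (ρ − 4j − 6)c′ + ((j+1)/2)c)(ρ) · x × ∇φ`. [folklore] -/
theorem profileOp_toroidalLift (hc : ContDiff ℝ ∞ c) (hφ : ContDiff ℝ ∞ φ) (hΔ : ∀ y, (Δ φ) y = 0)
    (hE : ∀ y, fderiv ℝ φ y y = (j : ℝ) * φ y) (y : EuclideanSpace ℝ (Fin 3)) :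
    -(Δ fun x : EuclideanSpace ℝ (Fin 3) => c (‖x‖ ^ 2) • cross x (gradient φ x)) y +
        (1 / 2 : ℝ) • (c (‖y‖ ^ 2) • cross y (gradient φ y)) +
        (1 / 2 : ℝ) • fderiv ℝ (fun x : EuclideanSpace ℝ (Fin 3) => c (‖x‖ ^ 2) • cross x (gradient φ x)) y y =
      (-4 * ‖y‖ ^ 2 * deriv (deriv c) (‖y‖ ^ 2) + (‖y‖ ^ 2 - 4 * (j : ℝ) - 6) * deriv c (‖y‖ ^ 2) +
        ((j : ℝ) + 1) / 2 * c (‖y‖ ^ 2)) • cross y (gradient φ y) := by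
  have hT : ContDiff ℝ ∞ (fun x : EuclideanSpace ℝ (Fin 3) => cross x (gradient φ x)) :=
    contDiff_crossSelf (contDiff_gradient' hφ)
  rw [laplacian_radial_smul hc hT y, laplacian_crossSelf_gradient_of_harmonic hφ hΔ y,
    fderiv_radial_smul_self (hc.differentiable (by simp)) (hT.differentiable (by simp)) y,
    fderiv_crossSelf_gradient_self hφ hE y]
  module

/-- **THE LERAY PROFILE OPERATOR ON THE THREE-LIFT ANSATZ** of a solid harmonic of degree `j`:
`A(a∇φ + bφx + c x×∇φ) = (𝔞 a − 2b)∇φ + (𝔟 b)φx + (𝔠 c) x×∇φ` with the explicit second-order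
radial operators (in `ρ = ‖y‖²`)
`𝔞 a = −4ρa″ + (ρ−4j−2)a′ + (j/2)a`, `𝔟 b = −4ρb″ + (ρ−4j−10)b′ + ((j+2)/2)b`,
`𝔠 c = −4ρc″ + (ρ−4j−6)c′ + ((j+1)/2)c` — the class is INVARIANT under the linear part of the
profile system, which acts as a triangular `3 × 3` radial operator. [cite: BullardGellman1954] -/
theorem profileOp_threeLift (ha : ContDiff ℝ ∞ a) (hb : ContDiff ℝ ∞ b) (hc : ContDiff ℝ ∞ c)
    (hφ : ContDiff ℝ ∞ φ) (hΔ : ∀ y, (Δ φ) y = 0) (hE : ∀ y, fderiv ℝ φ y y = (j : ℝ) * φ y)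
    (y : EuclideanSpace ℝ (Fin 3)) :
    -(Δ fun x : EuclideanSpace ℝ (Fin 3) =>
        a (‖x‖ ^ 2) • gradient φ x + b (‖x‖ ^ 2) • (φ x • x) + c (‖x‖ ^ 2) • cross x (gradient φ x)) y +
      (1 / 2 : ℝ) • (a (‖y‖ ^ 2) • gradient φ y + b (‖y‖ ^ 2) • (φ y • y) +
        c (‖y‖ ^ 2) • cross y (gradient φ y)) +
      (1 / 2 : ℝ) • fderiv ℝ (fun x : EuclideanSpace ℝ (Fin 3) =>
        a (‖x‖ ^ 2) • gradient φ x + b (‖x‖ ^ 2) • (φ x • x) + c (‖x‖ ^ 2) • cross x (gradient φ x)) y y =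
      (-4 * ‖y‖ ^ 2 * deriv (deriv a) (‖y‖ ^ 2) + (‖y‖ ^ 2 - 4 * (j : ℝ) - 2) * deriv a (‖y‖ ^ 2) +
          (j : ℝ) / 2 * a (‖y‖ ^ 2) - 2 * b (‖y‖ ^ 2)) • gradient φ y +
        (-4 * ‖y‖ ^ 2 * deriv (deriv b) (‖y‖ ^ 2) + (‖y‖ ^ 2 - 4 * (j : ℝ) - 10) * deriv b (‖y‖ ^ 2) +
          ((j : ℝ) + 2) / 2 * b (‖y‖ ^ 2)) • (φ y • y) +
        (-4 * ‖y‖ ^ 2 * deriv (deriv c) (‖y‖ ^ 2) + (‖y‖ ^ 2 - 4 * (j : ℝ) - 6) * deriv c (‖y‖ ^ 2) +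
          ((j : ℝ) + 1) / 2 * c (‖y‖ ^ 2)) • cross y (gradient φ y) := by
  have hG : ContDiff ℝ ∞ (gradient φ) := contDiff_gradient' hφ
  have hf1 : ContDiff ℝ ∞ fun x : EuclideanSpace ℝ (Fin 3) => a (‖x‖ ^ 2) • gradient φ x := contDiff_radial_smul ha hG
  have hf2 : ContDiff ℝ ∞ fun x : EuclideanSpace ℝ (Fin 3) => b (‖x‖ ^ 2) • (φ x • x) :=
    contDiff_radial_smul hb (contDiff_smulSelf hφ)
  have hf3 : ContDiff ℝ ∞ fun x : EuclideanSpace ℝ (Fin 3) => c (‖x‖ ^ 2) • cross x (gradient φ x) :=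
    contDiff_radial_smul hc (contDiff_crossSelf hG)
  have hf12 : ContDiff ℝ ∞ ((fun x : EuclideanSpace ℝ (Fin 3) => a (‖x‖ ^ 2) • gradient φ x) +
      fun x : EuclideanSpace ℝ (Fin 3) => b (‖x‖ ^ 2) • (φ x • x)) := hf1.add hf2
  have e : (fun x : EuclideanSpace ℝ (Fin 3) => a (‖x‖ ^ 2) • gradient φ x + b (‖x‖ ^ 2) • (φ x • x) +
      c (‖x‖ ^ 2) • cross x (gradient φ x)) =
      (fun x : EuclideanSpace ℝ (Fin 3) => a (‖x‖ ^ 2) • gradient φ x) +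
        (fun x : EuclideanSpace ℝ (Fin 3) => b (‖x‖ ^ 2) • (φ x • x)) +
        fun x : EuclideanSpace ℝ (Fin 3) => c (‖x‖ ^ 2) • cross x (gradient φ x) := rfl
  have h1 := profileOp_gradientLift ha hφ hΔ hE y
  have h2 := profileOp_radialLift hb hφ hΔ hE y
  have h3 := profileOp_toroidalLift hc hφ hΔ hE y
  rw [e, ((hf12.of_le (by norm_cast)).contDiffAt).laplacian_add ((hf3.of_le (by norm_cast)).contDiffAt),
    ((hf1.of_le (by norm_cast)).contDiffAt).laplacian_add ((hf2.of_le (by norm_cast)).contDiffAt),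
    fderiv_add ((hf12.differentiable (by simp)) y) ((hf3.differentiable (by simp)) y),
    fderiv_add ((hf1.differentiable (by simp)) y) ((hf2.differentiable (by simp)) y)]
  simp only [_root_.add_apply]
  linear_combination (norm := module) h1 + h2 + h3

end ProfileOperator

end Summit.NavierStokesRegularity.AngularGalerkinLadderSolidHarmonicProfileOperator

end
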